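import Mathlib
import HarnessLib
import HarnessLib.Audit
import Summits.QuantumAdvantage.Statement
import Literature.Computability.Complexity.Classes
import Literature.Computability.Complexity.ProbabilisticClasses
import Literature.Computability.Complexity.TimeBounds
import Literature.Computability.Complexity.Promise
import Literature.Computability.Cryptography.QuantumCircuit
import Literature.Computability.Cryptography.ClassBQP
import Literature.Computability.Complexity.RelativizedTime
import Literature.Computability.QuantumComplexity.BQTime
import HarnessLib.Audit.Status.Attr

/-!
Route: CompactnessLift

DORMANT since 2026-08-24T12:44:55Z (reconciler: no traction for 6.8 d (last activity item-evidence-added at 2026-08-17T17:28:52Z); parked, not closed — `ledger route dormant route-QuantumAdvantage-CompactnessLift --off` to reactivate) — unstaffed, not closed; items shared with open routes are served there. `ledger route dormant <id> --off` reactivates.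

# Route CompactnessLift — the lift that survives Fortnow–Rogers — language exponent ladder plus a
uniform-exponent (compactness) principle

It suffices to show X = CP ∧ ¬UC (realises idea card compactness-principle-lift). Write QuadQ for
the languages decided with error ≤ 1/3 by
oracle-free Clifford+T circuit families whose description 1ⁿ ↦ ⟨Qₙ⟩ is computable in time O(n²) (a
circuit-model BQTIME(n²)), and
BP·DTIME(n^c) = bp (DTIME (n ↦ n^c)). ¬UC (LanguageLadder, hypothesis-type): for every c some L ∈
QuadQ lies outside BP·DTIME(n^c).
CP (CompactnessPrinciple, the LIFT): if BQP ⊆ BPP then ONE exponent c serves all of QuadQ — "a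
dequantization, if it exists, has a
uniform exponent". CP is exactly (¬UC → S) and S → CP ∧ ¬UC by padding (support SummitGivesLadder),
so X ⟺ S; what the route claims
is the POSITION of CP: PlLift → CP (support PlImpliesCp), CP ∧ ¬PlLift is relativized-consistent (CP
is TRUE in the Fortnow–Rogers /
FFKL generic world, where every promise lift dies), CP ⟺ "the ladder is computably witnessed"
(Schöning–Ladner), and the computable
case of the union is free (McCreight–Meyer).
Lean: `(Literature.Computability.Cryptography.BQP ⊆ Literature.Computability.Complexity.BPP → ∃ c :
ℕ, {L : Language Bool | ∃ F : Literature.Computability.Cryptography.QCircuitFamily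
Literature.Computability.Cryptography.cliffordT, F.IsOracleFree ∧ (∃ C : ℕ,
Literature.Computability.Complexity.TimeComputable Computability.unaryEncodeNat
(Literature.Computability.Cryptography.QCircuit.sigmaEncode (G :=
Literature.Computability.Cryptography.cliffordT)) (fun n => (⟨n, F.ancillas n, F.circ n⟩ : Σ n m :
ℕ, Literature.Computability.Cryptography.QCircuit Literature.Computability.Cryptography.cliffordT (n
+ m))) (fun n => C * n ^ 2 + C)) ∧ ∀ x, (x ∈ L → 2 / 3 ≤ F.acceptProbOn 0 x) ∧ (x ∉ L →
F.acceptProbOn 0 x ≤ 1 / 3)} ⊆ Literature.Computability.Complexity.bp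
(Literature.Computability.Complexity.DTIME (fun n => n ^ c))) ∧ (∀ c : ℕ, ∃ L ∈ {L : Language Bool |
∃ F : Literature.Computability.Cryptography.QCircuitFamily
Literature.Computability.Cryptography.cliffordT, F.IsOracleFree ∧ (∃ C : ℕ,
Literature.Computability.Complexity.TimeComputable Computability.unaryEncodeNat
(Literature.Computability.Cryptography.QCircuit.sigmaEncode (G :=
Literature.Computability.Cryptography.cliffordT)) (fun n => (⟨n, F.ancillas n, F.circ n⟩ : Σ n m :
ℕ, Literature.Computability.Cryptography.QCircuit Literature.Computability.Cryptography.cliffordT (n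
+ m))) (fun n => C * n ^ 2 + C)) ∧ ∀ x, (x ∈ L → 2 / 3 ≤ F.acceptProbOn 0 x) ∧ (x ∉ L →
F.acceptProbOn 0 x ≤ 1 / 3)}, L ∉ Literature.Computability.Complexity.bp
(Literature.Computability.Complexity.DTIME (fun n => n ^ c)))`

## Assembly
Pure logic (sorry-free in Sketch.lean, and the deciding theorem closes): if S failed then BQP ⊆ BPP
(every BQP language in BPP), CP
gives a uniform exponent c for QuadQ, and ¬UC at that c gives L ∈ QuadQ outside BP·DTIME(n^c) —
contradiction.

Rationale: WHY THIS LINE. BARRIER-INVERSION (operator C). Assume the catalogue: SeparationPrerequisites makes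
every S-route conditional; Relativization +
SupremacyTheoremsNonRelativizing (Fortnow–Rogers Cor 3.7: P = BQP with PH infinite) +
PromiseLiftRelativization kill every relativizing
LIFT from a weaker-than-S frontier statement to S — PlLift (stmt-QuantumAdvantage-0250, shared by
PromiseLift and ExponentLadder), the
search lift, the pseudo-deterministic lift are all FALSE in that world. So any lift a route may hope
to PROVE must be a statement that
HOLDS in the Fortnow–Rogers/FFKL generic world. The compactness principle CP is the one such
candidate on the hub (card
compactness-principle-lift, unrouted, refuter-graded new-combination): in O = H ⊕ G the collapse
comes WITH a uniform exponent
(gapped T-query machines are total on generic subcubes, Beals et al. D ≤ 4096·Q₂⁶ gives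
deterministic query cost C·T⁶ with an ABSOLUTE
exponent, H supplies the computation), so CP^O holds while PlLift^O fails. Imported area: Blum's
abstract complexity (McCreight–Meyer
union theorem MccreightMeyer1969, Borodin gap, Schöning/Ladner uniform diagonalization Schoning1982,
Dziemba2017 for the quantum/promise
bookkeeping) and the relativized polynomial method (BealsEtAl2001, FennerFortnowKurtzLi2003,
FortnowRogers1999JCSS); classical twin of the
lift: Goldreich2011 §6 (BPP = P ⇒ prBPP = prP?), Tell2019 (why promise lifts are circuit-lower-bound
hard). What no open route does:
ExponentLadder and PromiseLift both hang on PlLift; this route replaces it by a strictly weaker,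
FR-surviving lift and moves the rungs
to LANGUAGES (no promise problem, no word-RAM model: the ∀c quantifier is model-invariant), and it
pays out theorems now (supports).

RANKED CRUXES. #2 CompactnessPrinciple (crux) — CP — if BQP ⊆ BPP then there is one exponent c with
QuadQ ⊆ BP·DTIME(n^c) (card K1; exactly the lift ¬UC → S). [difficulty: open-problem] (why it might
fail: false iff BQP ⊆ BPP with classical exponents unbounded over QuadQ — contradicts nothing known;
relativizingly unprovable iff OracleDichotomy is positive; known mechanisms are PlLift (stronger,
dies in FR) or selection arguments that stall because a quantum machine cannot certify its own gap.)
[Goldreich2011, Tell2019, FortnowRogers1999JCSS, Dziemba2017, arXiv:cs/9811023]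
#3 LanguageLadder (crux) — ¬UC — for every exponent c some quadratic-time-uniform Clifford+T
language lies outside BP·DTIME(n^c) (card K3; hypothesis-type: implied by S and by every padded
exponential conditional advantage; rung c < 2 from randomised SETH via Grover on padded CNF-SAT).
[difficulty: open-problem] (why it might fail: refuted iff a UNIFORM-exponent dequantization ∃c
QuadQ ⊆ BP·DTIME(n^c) is proved (which with SummitGivesLadder refutes S itself); beyond the rSETH
rung every known rung is Shor-dominated padding; unconditionally even c = 2 is out of reach (no
BPTIME hierarchy).) [CalabroImpagliazzoPaturiIWPEC2009, Grover1996, Shor1997,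
BernsteinVazirani1997SICOMP]
#9 UnionTheorem (support) — McCreight–Meyer for P in the tree's TM2 model: one computable
(non-time-constructible) bound t with P = DTIME(t); hence BPP = bp (DTIME t) by rfl — the computable
case of the union CP asks for is free (card T2/P2). [difficulty: M] [MccreightMeyer1969,
doi:10.1016/0304-3975(78)90041-5]
#9 PlImpliesCp (support) — the promise lift PlLift (BQP ⊆ BPP → PromiseBQP ⊆ PromiseBPP',
stmt-QuantumAdvantage-0250 restated) implies CP: the universal gapped-circuit promise problem is in
PromiseBQP, PromiseBPP' puts it in some BP·DTIME(n^{c₀}), and every QuadQ language reduces to it in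
time O(n²) (card P3). [difficulty: L] [Goldreich2011, Watrous2009, AaronsonAmbainis2018]
#9 SummitGivesLadder (support) — padding — S already gives the ladder: a BQP language outside BPP
pads into QuadQ and stays outside every BP·DTIME(n^c); with the assembly this makes X ⟺ S explicit
and tests the typing of QuadQ (card P3, tree PadDecider machinery). [difficulty: M]
[BernsteinVazirani1997SICOMP, Schoning1982]
#9 QuadSubsetBQP (support) — sanity of the class — QuadQ ⊆ BQP (an O(n²)-time sigma-encoder is a
poly-time uniformity witness); proved in the planner sketch (rc 0). [difficulty: provable-now]
[BernsteinVazirani1997SICOMP, Watrous2009]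

TWO-LAYER PLAN. CompactnessPrinciple ⇐ SelectionPrinciple (¬UC → computably witnessed ¬UC) →
ComputableLadderIffSummit (T1) → CompactnessPrinciple;
LanguageLadder ⇐ SethLanguageRung (c < 2) → PaddedExponentialRungs (all c, under 2^{n^δ}-hardness of
one BQP problem) → LanguageLadder (k ≤ 3, depth 1).
OracleDichotomy (informal crux 4, filed after open) splits into a construction attempt (collapse
with unbounded overhead from a
language-form Aaronson–Ambainis statement) and a non-existence attempt (relativizing selection proof
of CP).

KILL CRITERIA. A proof of UC (∃c QuadQ ⊆ BP·DTIME(n^c)) refutes LanguageLadder and, through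
SummitGivesLadder, the summit: close refuted:LanguageLadder
and hand the theorem to the ¬S routes. OracleDichotomy POSITIVE (an oracle with BQP = BPP but
unbounded overhead) ⇒ CP needs a
non-relativizing selection mechanism nobody has: demote to structure-only (dormant) unless one is
named within a tenure cycle.
OracleDichotomy NEGATIVE by a relativizing proof of CP ⇒ S ⟺ ¬UC is a theorem: close superseded
(items migrate to ExponentLadder as the
language form of its ladder). PlLift proved elsewhere moots CP (PlImpliesCp). SummitGivesLadder
refuted ⇒ QuadQ is mis-typed: re-type
once (cubic description budget), not twice.

NOT DECOMPOSED YET. T1 (S ⟺ computably witnessed ladder: Schöning/Ladner delayed diagonalization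
over gapped clocked quantum machines) and T3 (in the
FFKL/Fortnow–Rogers world ∃c₀ ∀k BQTIME^O(n^k) ⊆ DTIME^O(n^{c₀k}) ∧ PromiseBQP^O ⊄ PromiseBPP'^O)
need relativized / clocked time-bounded
quantum classes the tree lacks — filed as informal supports after open together with OracleDichotomy
(crux 4) and SethLanguageRung;
the Borodin-gap corollary; the classical twin (BPP = P ⇒ ∃c BPTIME(n) ⊆ DTIME(n^c)) as a calibration
item.

CHEAPEST FALSIFIER. (i) Literature: is the classical twin of CP settled in the derandomization
literature? (searched crossref 2026-08-16: Goldreich2011 §6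
poses prBPP = prP vs BPP = P as open; Tell2019 shows prBPP = prP needs 'almost NP ⊄ P/poly' —
consistent with CP being the weaker,
untouched statement; nothing found settling it). (ii) An easy oracle making OracleDichotomy positive
(a sparse tally-coded ladder uniform
machines provably cannot aggregate) — would demote CP to 'non-relativizing like PlLift' on day one.
(iii) Typing: can a TM2 sigma-encoder
re-emit a size-n^k circuit on N = n^k input wires in O(N²) steps (needed by SummitGivesLadder)? If
not, QuadQ is mis-typed.

NUMBERS. Generic-world uniform exponent: deterministic query cost ≤ 4096·Q₂⁶ (BealsEtAl2001 Thm
5.4), so c₀ = 6 + O(1) overhead in T3; improved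
to 4 by Aaronson–Ben-David–Kothari–Rao–Tal (D = O(Q⁴)). rSETH rung: SAT_pad ∈ QuadQ (Grover,
N·polylog N gates at N = 2^{v/2}) and
∉ BP·DTIME(N^{2−ε}) under randomised SETH (CalabroImpagliazzoPaturiIWPEC2009) — rung c = 1 of
LanguageLadder. Items at open: 7 (2 cruxes,
4 supports, 1 assembly); 4 informal items to follow (1 crux, 3 supports); total ≤ 11.

DEFINITION REQUESTS. BQTimeUniform t (Literature/Computability/QuantumComplexity): languages decided
with error ≤ 1/3 by oracle-free Clifford+T families whose
sigma-encoding is TimeComputable in t — to replace the inlined comprehension QuadQ = BQTimeUniform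
(n ↦ C·n²+C); BQTimeRel / BPTimeRel
(relativized, time-indexed; for OracleDichotomy and T3); GappedClockedQTMCode (for T1).

Novelty: Searches (2026-08-16): hub: all 200 QuantumAdvantage cards (ledger idea list --status all)
keyword-scanned (union theorem / McCreight /
Schöning / compactness / selection: only card compactness-principle-lift), route files
ExponentLadder (uniformity appears only as kill
criterion 'uniform-in-k FPT dequantization', item 2460) and PromiseLift read; `lit frontier
QuantumAdvantage --since 2024` (30 rows, none
on lifts); crossref "union theorem complexity classes McCreight Meyer" (6: MccreightMeyer1969, van
Emde Boas 1978), crossref "BPP = P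
implies prBPP = prP uniform exponent derandomization" (6: Goldreich–Wigderson 1999, Tell2019),
crossref "uniform simulation exponent
quantum classical BQP BPP padding" (6, all simulation papers, none structural); `lit galaxy search
"union theorem" --star all` (20 rows,
noise) and "uniform diagonalization BQP" (0); arXiv "delayed diagonalization promise classes BQP BPP
Ladner" (0; Dziemba2017 known via
the card); S2/OpenAlex rate-limited (429) this session.
Nearest prior art found: route-QuantumAdvantage-ExponentLadder (WidthLadder stmt-2460 + PlLift
stmt-0250: exponent ladder for ONE
PromiseBQP-complete problem, promise-level lift); route-QuantumAdvantage-PromiseLift (PlLift);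
Dziemba2017 = arXiv:1712.07276 (UDT for
BQP/BPP promise classes, no exponent content); MccreightMeyer1969 = doi:10.1145/800169.805423 (union
theorem, classical, never aimed at
a quantum lift); Goldreich2011 = doi:10.1007/978-3-642-22670-0_20 §6 and Tell2019 = doi:10.1016  [refs: 10.1145/800169.805423, 10.1007/978-3-642-22670-0_20, 10.1016/j.ipl.2019.105841, 1712.07276, doi:10.1145/800169.805423, doi:10.1007/978-3-642-22670-0_20, doi:10.1016/j.ipl.2019.105841, MccreightMeyer1969, Tell2019, Dziemba2017, Goldreich2011]

Barriers (technique_class: structural, union-theorem, uniform-diagonalization): - technique_class: structural, union-theorem, uniform-diagonalization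
- Literature.Barriers.QuantumAdvantage.PromiseLiftRelativization: EVADED by construction — the
barrier kills lifts that are false in the P = BQP ∧ PH-infinite (Fortnow–Rogers / FFKL generic)
world; CP HOLDS there with the uniform exponent the polynomial method supplies (support T3, filed
informal), while PlLift fails; this is the clause escaped.
- Literature.Barriers.QuantumAdvantage.SupremacyTheoremsNonRelativizing: clause (a) (Fortnow–Rogers
Cor 3.7) is the same world — same evasion for CP; whether CP has a relativizing PROOF is exactly
crux OracleDichotomy (engaged head-on, informative both ways).
- Literature.Barriers.QuantumAdvantage.Relativization: X ⟺ S, so X itself inherits the summit's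
contrary oracles (conceded); the route's provable content (supports, T1–T3, OracleDichotomy) is
relativized/structural mathematics that the barrier does not touch.
- Literature.Barriers.QuantumAdvantage.SeparationPrerequisites: applies a fortiori (X ⟺ S): the
route is conditional on LanguageLadder, a hypothesis-type ladder never staffed for unconditional
proof beyond its rSETH rung — conceded, as for every S-route.
- Literature.Barriers.QuantumAdvantage.TotalFunctionSpeedupLimit: consistent and USED — the
total-function polynomial method (D ≤ 4096·Q₂⁶) is the engine of CP's truth in generic worlds.
- Literature.Barriers.QuantumAdvantage.Algebrization / NaturalProofs / PPolyOracles /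
RandomOracleMethod / BoundedEntang

History (route lifecycle, newest last):
- 2026-08-24T12:44:55Z · DORMANT — reconciler: no traction for 6.8 d (last activity item-evidence-added at 2026-08-17T17:28:52Z); parked, not closed — `ledger route dormant route-QuantumAdvantage (operator:999:2177129)

sub-problem: QuantumAdvantage · status: dormant · opened planner-plan-novel-QuantumAdvantage-QuantumAdva-e0108269-c-g2-0 2026-08-16T14:58:03Z · rev 1 · ledger route-QuantumAdvantage-CompactnessLift
GENERATED by the gate from the ledger (D-0016/17). Provers cite these decls: `theorem foo : Summit.QuantumAdvantage.QuantumAdvantage.Theses.CompactnessLift.<Decl> := …` in Summits/QuantumAdvantage/QuantumAdvantage/Theorems/<Name>.lean.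
-/

namespace Summit.QuantumAdvantage.QuantumAdvantage.Theses.CompactnessLift

open scoped BigOperators Topology Manifold Classical MeasureTheory ProbabilityTheory Matrix InnerProductSpace ComplexConjugate ContinuousMap
open Filter Set Function TopologicalSpace MeasureTheory

attribute [summit_statement] _root_.QuantumAdvantage

open Literature.QuantumAdvantage

/-- item stmt-QuantumAdvantage-18126 · crux · rank 2 · open · by planner
why it might fail: False iff BQTIME(n^2) ⊆ BPP holds with classical exponents unbounded in the description constant (an OracleDichotomy-positive world made real); no technique known — it is S ∨ uniform dequantization; relativizingly unprovable iff 15277 is positive; must hold in the PromiseLiftRelativization oracle.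
sources: FortnowRogers1999JCSS, Goldreich2011, Tell2019, MccreightMeyer1969, Dziemba2017
[crux] HONEST compactness principle on the quadratic window (child of LanguageLadder, strategist
split D0; Cruxes/LanguageLadder/STRATEGY-CENSUS.md §1, CensusG1.lean): if every
quadratic-time-uniform Clifford+T language is in BPP then ONE exponent c puts them all in honest
BPTIME(n^c) (RelativizedTime.BPTime: O(n^c) coins AND time). Pure-logic identity: this ↔
(LanguageLadderR → LanguageLadder); vacuous under S, contentful exactly under ¬S; true with an
explicit exponent in the FFKL/Fortnow–Rogers generic world (15279a); PlLift → this (honest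
PlImpliesCp, L-sized real theorem). Kill test: OracleDichotomy 15277. First idea: the log-T-count
scale model (census T9c). Why it might fail: False iff BQTIME(n^2) ⊆ BPP holds with unbounded
exponents (an OracleDichotomy-positive world made real); no technique known — it is S ∨ uniform
dequantization; relativizingly unprovable iff 15277 is positive; must also hold in the
PromiseLiftRelativization oracle (QA-A08). Sources: FortnowRogers1999JCSS, Goldreich2011, Tell2019,
MccreightMeyer1969, Dziemba2017. -/
@[route_item "route-QuantumAdvantage-CompactnessLift", crux]
def UniformExponentLift : Prop :=
  Literature.Computability.QuantumComplexity.BQTime (fun n => n ^ 2) ⊆ Literature.Computability.Complexity.BPP → ∃ c : ℕ, Literature.Computability.QuantumComplexity.BQTime (fun n => n ^ 2) ⊆ Literature.Computability.Complexity.BPTime (fun n => n ^ c)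

/-- item stmt-QuantumAdvantage-18127 · crux · rank 6 · open · by planner
why it might fail: Refuted iff a uniform-exponent dequantization ∃c BQTIME(n^2) ⊆ BPTIME(n^c) lands (refutes S too); rungs c ≥ 4 are padded Shor (summit-strength), even rung 1 is open unconditionally (no BPTIME hierarchy); tail ⇒ PP ⊄ BPP mod folklore — HYPOTHESIS-TYPE: refuters first; only rSETH rungs 0–3 provable.
sources: CalabroImpagliazzoPaturiIWPEC2009, Grover1996, BernsteinVazirani1997SICOMP, AroraBarakCC2009
[crux] the HONEST fixed-exponent language ladder (child of LanguageLadder; refuter rattack-15271's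
repair C′ verbatim, LeadVerdict.LanguageLadderRepaired, Disproof §6): for every c some
quadratic-time-uniform Clifford+T language lies outside honest BPTIME(n^c). HYPOTHESIS-TYPE: implied
by the parent unconditionally and by S modulo 15274; implies PP ⊄ BPP modulo folklore (Ideator2Notes
B0) — never seat a lead to prove its tail outright (QA-A03). Provable content: conditional rungs 0–3
from randomized SETH via Grover/BBHT on padded CNF-SAT (15280 re-priced by BarrierNotes LL-B3); rung
0 unconditional (XXL). Why it might fail: Refuted iff a UNIFORM-exponent dequantization ∃c
BQTIME(n^2) ⊆ BPTIME(n^c) is proved (which refutes S too); beyond the rSETH rungs 0–3 every rung is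
padded Shor (summit-strength); unconditionally even rung 1 is open (no advice-free BPTIME hierarchy,
no randomized linear-time lower bounds). Sources: CalabroImpagliazzoPaturiIWPEC2009, Grover1996,
BernsteinVazirani1997SICOMP, AroraBarakCC2009. -/
@[route_item "route-QuantumAdvantage-CompactnessLift", crux]
def LanguageLadderR : Prop :=
  ∀ c : ℕ, ∃ L ∈ Literature.Computability.QuantumComplexity.BQTime (fun n => n ^ 2), L ∉ Literature.Computability.Complexity.BPTime (fun n => n ^ c)

/-- item stmt-QuantumAdvantage-15270 · support · rank 2 · closed · proved by Summit.QuantumAdvantage.QuantumAdvantage.Theorems.CompactnessLiftPadding.compactnessPrinciple_proof @ b170af530438 (prover) · by planner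
why it might fail: false iff BQP ⊆ BPP with classical exponents unbounded over QuadQ — contradicts nothing known; relativizingly unprovable iff OracleDichotomy is positive; known mechanisms are PlLift (stronger, dies in FR) or selection arguments that stall because a quantum machine cannot certify its own gap.
sources: Goldreich2011, Tell2019, FortnowRogers1999JCSS, Dziemba2017, arXiv:cs/9811023
[crux] CP — if BQP ⊆ BPP then there is one exponent c with QuadQ ⊆ BP·DTIME(n^c) (card K1; exactly
the lift ¬UC → S). [difficulty: open-problem] -/
@[route_item "route-QuantumAdvantage-CompactnessLift"]
def CompactnessPrinciple : Prop :=
  Literature.Computability.Cryptography.BQP ⊆ Literature.Computability.Complexity.BPP → ∃ c : ℕ, {L : Language Bool | ∃ F : Literature.Computability.Cryptography.QCircuitFamily Literature.Computability.Cryptography.cliffordT, F.IsOracleFree ∧ (∃ C : ℕ, Literature.Computability.Complexity.TimeComputable Computability.unaryEncodeNat (Literature.Computability.Cryptography.QCircuit.sigmaEncode (G := Literature.Computability.Cryptography.cliffordT)) (fun n => (⟨n, F.ancillas n, F.circ n⟩ : Σ n m : ℕ, Literature.Computability.Cryptography.QCircuit Literature.Computability.Cryptography.cliffordT (n + m)))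 (fun n => C * n ^ 2 + C)) ∧ ∀ x, (x ∈ L → 2 / 3 ≤ F.acceptProbOn 0 x) ∧ (x ∉ L → F.acceptProbOn 0 x ≤ 1 / 3)} ⊆ Literature.Computability.Complexity.bp (Literature.Computability.Complexity.DTIME (fun n => n ^ c))

/-- item stmt-QuantumAdvantage-15271 · aside · rank 3 · open · by planner
why it might fail: refuted iff a UNIFORM-exponent dequantization ∃c QuadQ ⊆ BP·DTIME(n^c) is proved (which with SummitGivesLadder refutes S itself); beyond the rSETH rung every known rung is Shor-dominated padding; unconditionally even c = 2 is out of reach (no BPTIME hierarchy).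
sources: CalabroImpagliazzoPaturiIWPEC2009, Grover1996, Shor1997, BernsteinVazirani1997SICOMP
[crux] ¬UC — for every exponent c some quadratic-time-uniform Clifford+T language lies outside
BP·DTIME(n^c) (card K3; hypothesis-type: implied by S and by every padded exponential conditional
advantage; rung c < 2 from randomised SETH via Grover on padded CNF-SAT). [difficulty: open-problem] -/
@[route_item "route-QuantumAdvantage-CompactnessLift"]
def LanguageLadder : Prop :=
  ∀ c : ℕ, ∃ L ∈ {L : Language Bool | ∃ F : Literature.Computability.Cryptography.QCircuitFamily Literature.Computability.Cryptography.cliffordT, F.IsOracleFree ∧ (∃ C : ℕ, Literature.Computability.Complexity.TimeComputable Computability.unaryEncodeNat (Literature.Computability.Cryptography.QCircuit.sigmaEncode (G := Literature.Computability.Cryptography.cliffordT)) (fun n => (⟨n, F.ancillas n, F.circ n⟩ : Σ n m : ℕ, Literature.Computability.Cryptography.QCircuit Literature.Computability.Cryptography.cliffordT (n + m))) (fun n => C * n ^ 2 + C)) ∧ ∀ x, (x ∈ L → 2 / 3 ≤ F.acceptProbOn 0 x) ∧ (x ∉ L → F.acceptProbOn 0 x ≤ 1 / 3)}, L ∉ Literature.Computability.Complexity.bp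 (Literature.Computability.Complexity.DTIME (fun n => n ^ c))

-- item stmt-QuantumAdvantage-15277 · support · rank 4 · open · by planner — informal only, no Lean statement yet:
--   [crux] ORACLE DICHOTOMY (card K2): decide whether there is an oracle O with BQP^O ⊆ BPP^O and yet ∀c
--   ∃L ∈ BQTIME^O(n²) ∖ BPTIME^O(n^c) ("collapse with unbounded overhead"). Positive ⇒
--   CompactnessPrinciple has no relativizing proof (like PlLift); negative by a relativizing argument ⇒
--   CP relativizes and S ⟺ LanguageLadder. Why it might fail: possibly Aaronson–Ambainis-hard — a
--   construction seems to need worst-case P^{H⊕R}-simulation of uniform gapped BQP^{H⊕R} machines on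
--   random regions R (language form of AA14 Conj. 6 / Thm 7), while non-existence needs a gap-free
--   selection proof nobody has; un

/-- item stmt-QuantumAdvantage-15272 · support · rank 9 · open · by planner
sources: MccreightMeyer1969, doi:10.1016/0304-3975(78)90041-5
[support] McCreight–Meyer for P in the tree's TM2 model: one computable (non-time-constructible)
bound t with P = DTIME(t); hence BPP = bp (DTIME t) by rfl — the computable case of the union CP
asks for is free (card T2/P2). [difficulty: M] -/
@[route_item "route-QuantumAdvantage-CompactnessLift"]
def UnionTheorem : Prop :=
  ∃ t : ℕ → ℕ, Computable t ∧ Literature.Computability.Complexity.Classes.P = Literature.Computability.Complexity.DTIME t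

/-- item stmt-QuantumAdvantage-15273 · support · rank 9 · closed · proved by Summit.QuantumAdvantage.QuantumAdvantage.Theorems.CompactnessLiftLanguageLadder.plImpliesCp_proof @ 62ea362efa1a (prover) · by planner
sources: Goldreich2011, Watrous2009, AaronsonAmbainis2018
[support] the promise lift PlLift (BQP ⊆ BPP → PromiseBQP ⊆ PromiseBPP', stmt-QuantumAdvantage-0250
restated) implies CP: the universal gapped-circuit promise problem is in PromiseBQP, PromiseBPP'
puts it in some BP·DTIME(n^{c₀}), and every QuadQ language reduces to it in time O(n²) (card P3).
[difficulty: L] -/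
@[route_item "route-QuantumAdvantage-CompactnessLift"]
def PlImpliesCp : Prop :=
  (Literature.Computability.Cryptography.BQP ⊆ Literature.Computability.Complexity.BPP → Literature.Computability.Cryptography.PromiseBQP ⊆ Literature.Computability.Complexity.PromiseBPP') → (Literature.Computability.Cryptography.BQP ⊆ Literature.Computability.Complexity.BPP → ∃ c : ℕ, {L : Language Bool | ∃ F : Literature.Computability.Cryptography.QCircuitFamily Literature.Computability.Cryptography.cliffordT, F.IsOracleFree ∧ (∃ C : ℕ, Literature.Computability.Complexity.TimeComputable Computability.unaryEncodeNat (Literature.Computability.Cryptography.QCircuit.sigmaEncode (G := Literature.Computability.Cryptography.cliffordT)) (fun n => (⟨n, F.ancillas n, F.circ n⟩ : Σ n m : ℕ, Literature.Computability.Cryptography.QCircuit Literature.Computability.Cryptography.cliffordT (n + m))) (fun n => C * n ^ 2 + C)) ∧ ∀ x, (x ∈ L → 2 / 3 ≤ F.acceptProbOn 0 x) ∧ (x ∉ L → F.acceptProbOn 0 x ≤ 1 / 3)} ⊆ Literature.Computability.Complexity.bp (Literature.Computability.Complexity.DTIME (fun n => n ^ c)))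

/-- item stmt-QuantumAdvantage-15274 · support · rank 9 · open · by planner
sources: BernsteinVazirani1997SICOMP, Schoning1982
[support] padding — S already gives the ladder: a BQP language outside BPP pads into QuadQ and stays
outside every BP·DTIME(n^c); with the assembly this makes X ⟺ S explicit and tests the typing of
QuadQ (card P3, tree PadDecider machinery). [difficulty: M] -/
@[route_item "route-QuantumAdvantage-CompactnessLift"]
def SummitGivesLadder : Prop :=
  QuantumAdvantage → ∀ c : ℕ, ∃ L ∈ {L : Language Bool | ∃ F : Literature.Computability.Cryptography.QCircuitFamily Literature.Computability.Cryptography.cliffordT, F.IsOracleFree ∧ (∃ C : ℕ, Literature.Computability.Complexity.TimeComputable Computability.unaryEncodeNat (Literature.Computability.Cryptography.QCircuit.sigmaEncode (G := Literature.Computability.Cryptography.cliffordT)) (fun n => (⟨n, F.ancillas n, F.circ n⟩ : Σ n m : ℕ, Literature.Computability.Cryptography.QCircuit Literature.Computability.Cryptography.cliffordT (n + m))) (fun n => C * n ^ 2 + C)) ∧ ∀ x, (x ∈ L → 2 / 3 ≤ F.acceptProbOn 0 x) ∧ (x ∉ L → F.acceptProbOn 0 x ≤ 1 / 3)}, L ∉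 Literature.Computability.Complexity.bp (Literature.Computability.Complexity.DTIME (fun n => n ^ c))

/-- item stmt-QuantumAdvantage-15275 · support · rank 9 · closed · proved by Summit.QuantumAdvantage.QuantumAdvantage.Theorems.quadSubsetBQP_proof @ 4415895277dc (prover) · by planner
sources: BernsteinVazirani1997SICOMP, Watrous2009
[support] sanity of the class — QuadQ ⊆ BQP (an O(n²)-time sigma-encoder is a poly-time uniformity
witness); proved in the planner sketch (rc 0). [difficulty: provable-now] -/
@[route_item "route-QuantumAdvantage-CompactnessLift"]
def QuadSubsetBQP : Prop :=
  {L : Language Bool | ∃ F : Literature.Computability.Cryptography.QCircuitFamily Literature.Computability.Cryptography.cliffordT, F.IsOracleFree ∧ (∃ C : ℕ, Literature.Computability.Complexity.TimeComputable Computability.unaryEncodeNat (Literature.Computability.Cryptography.QCircuit.sigmaEncode (G := Literature.Computability.Cryptography.cliffordT)) (fun n => (⟨n, F.ancillas n, F.circ n⟩ : Σ n m : ℕ, Literature.Computability.Cryptography.QCircuit Literature.Computability.Cryptography.cliffordT (n + m))) (fun n => C * n ^ 2 + C)) ∧ ∀ x, (x ∈ L → 2 / 3 ≤ F.acceptProbOn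 0 x) ∧ (x ∉ L → F.acceptProbOn 0 x ≤ 1 / 3)} ⊆ Literature.Computability.Cryptography.BQP

-- item stmt-QuantumAdvantage-15278 · support · rank 9 · open · by planner — informal only, no Lean statement yet:
--   [support] T1 (card P1): QuantumAdvantage ↔ the language ladder is COMPUTABLY witnessed — there is a
--   computable sequence c ↦ Q_c of codes of quantum machines, each (2/3,1/3)-gapped on all inputs and
--   clocked n², with L(Q_c) ∉ BPTIME(n^c). (→) Schöning/Ladner delayed diagonalization: interleave the
--   L(Q_c) by a stage function computed by log n steps of replay, ending stage ⟨j,c⟩ when the j-th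
--   n^c-clocked PTM is caught erring on L(Q_c) by brute force; the interleaved language is decided in
--   quantum time n²·polylog and lies outside BPP. (←) constant sequence from a padded witness.
--   Consequence: Compac

-- item stmt-QuantumAdvantage-15279 · support · rank 9 · open · by planner — informal only, no Lean statement yet:
--   [support] T3 (card P4): relative to O = H ⊕ G (H PSPACE-complete, G Cohen/FFKL-generic; tree:
--   fennerFortnowKurtzLi2003_thm618_awpp, fortnowRogers1999_cor37, isInfinitePHRel_join_generic) (a) ∃c₀
--   ∀k BQTIME^O(n^k) ⊆ DTIME^O(n^{c₀k}) — the FFKL/Fortnow–Rogers collapse with its exponent made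
--   EXPLICIT and UNIFORM: the acceptance polynomial of a T-query machine gapped on all extensions of a
--   generic condition is bounded on the whole subcube, so Beals et al. (D ≤ 4096·Q₂⁶, BealsEtAl2001 Thm
--   5.4) gives deterministic query cost ≤ C·T⁶ with an absolute exponent and H supplies the computation;
--   (b) Promise

-- item stmt-QuantumAdvantage-15280 · support · rank 9 · open · by planner — informal only, no Lean statement yet:
--   [support] rSETH rung of LanguageLadder (language form of ExponentLadder.SethRung,
--   stmt-QuantumAdvantage-2461): randomised SETH ⇒ SAT_pad := {(φ, 1^{2^{⌈v/2⌉}}) : φ a satisfiable CNF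
--   on v variables} is in QuadQ (Grover with the BBHT schedule: N·polylog N Clifford+T gates at N =
--   2^{v/2}, description computable in O(N²)) and not in bp (DTIME (n ↦ n)) — indeed not in
--   BP·DTIME(N^{2−ε}) for any ε > 0. Conditional theorem; the c ≥ 2 rungs currently come only from
--   padded exponential conditional advantages (Shor under 2^{n^δ}-hardness of FACT). Sources:
--   CalabroImpagliazzoPaturiIWPEC2009, Grover1996, Bo

/-- item stmt-QuantumAdvantage-15276 · assembly · rank 1 · closed · proved by Summit.QuantumAdvantage.QuantumAdvantage.Theorems.compactnessLift_assembly_proof @ 36c48e7ce0c1 (prover) · by planner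
sources: MccreightMeyer1969, FortnowRogers1999JCSS
[assembly] CompactnessPrinciple → LanguageLadder → QuantumAdvantage. -/
@[route_item "route-QuantumAdvantage-CompactnessLift"]
def Assembly : Prop :=
  CompactnessPrinciple → LanguageLadder → QuantumAdvantage

/-! D-0027 §2.1 — DECIDING THEOREM (planner-authored via `route open/edit --closes-file`; by planner-rrepair-QuantumAdvantage-CompactnessLi-37af7b65-0 2026-08-17T13:41:50Z):
its hypotheses are this route's items and its conclusion the sub-problem Statement (glue_lint), and it elaborates with this file. -/

@[closes "route-QuantumAdvantage-CompactnessLift"] theorem closes (h₁ : UniformExponentLift) (h₂ : LanguageLadderR) : _root_.QuantumAdvantage := by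
  -- It suffices to show UEL ∧ LLR (the thesis CP ∧ ¬UC typed honestly over BQTIME(n²)/BPTIME(n^c)):
  -- if the summit failed, every BQP language — in particular every quadratic-time-uniform
  -- Clifford+T language (`BQTime_pow_subset_BQP 2`) — would be in BPP; the uniform-exponent lift
  -- then gives ONE exponent c with BQTIME(n²) ⊆ BPTIME(n^c), and rung c of the honest ladder
  -- exhibits a BQTIME(n²) language outside BPTIME(n^c) — contradiction.
  by_contra hS
  have hsub : Literature.Computability.QuantumComplexity.BQTime (fun n => n ^ 2) ⊆
      Literature.Computability.Complexity.BPP := by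
    intro L hL
    by_contra hLB
    exact hS ⟨L, Literature.Computability.QuantumComplexity.BQTime_pow_subset_BQP 2 hL, hLB⟩
  obtain ⟨c, hc⟩ := h₁ hsub
  obtain ⟨L, hL, hLc⟩ := h₂ c
  exact hLc (hc hL)

end Summit.QuantumAdvantage.QuantumAdvantage.Theses.CompactnessLift
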